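import Literature.Computability.AlgebraicComplexity.PartitionedTensors
import HarnessLib

/-!
# A tensor is a restriction of the direct sum of its cells
(the "merging" step in the proof of Thm. 5.3 of Vassilevska Williams–Xu–Xu–Zhou 2024) — proved

Topic `Literature/Computability/AlgebraicComplexity`.  The proof of Theorem 5.3 of Vassilevska
Williams–Xu–Xu–Zhou (SODA 2024, arXiv:2307.07970, §5, p. 19) produces, from `2^{o(n)}` copies of the
input, independent copies of the level-`ℓ` interface tensors for all the (polynomially many) exact
split types near the target distributions, and then: "Finally, we merge the level-`ℓ` interface
tensors into a level-`ℓ` `ε`-interface tensor."  The algebra of this merging is the following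
general fact, PROVED here: partition the variables of a tensor `T` by part maps `p_X, p_Y, p_Z`;
the **cells** of `T` are the sub-tensors `T‖_{{a},{b},{c}}` over one part in each dimension; then

* `tensorRestrictsTo_directSum_cells` — **`⊕_{(a,b,c)} T‖_{{a},{b},{c}} ≥ T`**: the direct sum of
  all cells restricts to `T` (forget the cell label: every entry of `T` lies in exactly one cell);
* `tensorRestrictsTo_directSum_cells_of_subset` — the same with the sum restricted to any family of
  cells containing all the non-zero cells.

(So a tensor whose cells are all copies of interface tensors — such as an `ε`-interface tensor,
whose cells by realised split types are exact interface tensors — is a degeneration of the direct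
sum of those.)  Everything is proved; no definitions; no named facts.

## References

* V. Vassilevska Williams, Y. Xu, Z. Xu, R. Zhou, *New bounds for matrix multiplication: from alpha
  to omega*, SODA 2024, arXiv:2307.07970 (held: `paper:arxiv-2307.07970`), Thm. 5.3 (proof sketch,
  "merge"). [VassilevskaWilliamsXuXuZhou2024]
* P. Bürgisser, M. Clausen, M. A. Shokrollahi, *Algebraic Complexity Theory*, Springer 1997, §14.2
  (restrictions, direct sums). [BurgisserClausenShokrollahi1997]
-/

noncomputable section

open scoped BigOperators
open Finset

namespace Literature.Computability.AlgebraicComplexity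

universe u

variable {K : Type u} [CommSemiring K]
variable {X Y Z PX PY PZ : Type*} [Fintype X] [Fintype Y] [Fintype Z] [DecidableEq X] [DecidableEq Y]
  [DecidableEq Z] [Fintype PX] [Fintype PY] [Fintype PZ] [DecidableEq PX] [DecidableEq PY] [DecidableEq PZ]
variable (pX : X → PX) (pY : Y → PY) (pZ : Z → PZ)

/-- **The direct sum of all cells restricts to the tensor**: `⊕_{(a,b,c)} T‖_{{a},{b},{c}} ≥ T`
(forgetting the cell labels sums, at each entry, over the unique cell containing it).
[cite: VassilevskaWilliamsXuXuZhou2024, Thm. 5.3 (proof: "we merge the level-ℓ interface tensors into a level-ℓ ε-interface tensor")] -/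
theorem tensorRestrictsTo_directSum_cells (T : X → Y → Z → K) :
    TensorRestrictsTo
      (familyDirectSum fun j : PX × PY × PZ => partSubtensor pX pY pZ T {j.1} {j.2.1} {j.2.2}) T := by
  have h := familyDirectSum_le_sum_blocks
    (fun j : PX × PY × PZ => partSubtensor pX pY pZ T {j.1} {j.2.1} {j.2.2})
    (fun _ (x'' : X) x => if x'' = x then (1 : K) else 0) (fun _ (y'' : Y) y => if y'' = y then (1 : K) else 0)
    (fun _ (z'' : Z) z => if z'' = z then (1 : K) else 0)
  have key : (fun x'' y'' z'' => ∑ j : PX × PY × PZ, ∑ x, ∑ y, ∑ z,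
      (if x'' = x then (1 : K) else 0) * (if y'' = y then (1 : K) else 0) * (if z'' = z then (1 : K) else 0) *
        partSubtensor pX pY pZ T {j.1} {j.2.1} {j.2.2} x y z) = T := by
    funext x'' y'' z''
    have inner : ∀ j : PX × PY × PZ, (∑ x, ∑ y, ∑ z,
        (if x'' = x then (1 : K) else 0) * (if y'' = y then (1 : K) else 0) * (if z'' = z then (1 : K) else 0) *
          partSubtensor pX pY pZ T {j.1} {j.2.1} {j.2.2} x y z) =
        partSubtensor pX pY pZ T {j.1} {j.2.1} {j.2.2} x'' y'' z'' := by
      intro j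
      rw [Finset.sum_eq_single x'' (fun x _ hx => by simp [Ne.symm hx]) (by simp),
        Finset.sum_eq_single y'' (fun y _ hy => by simp [Ne.symm hy]) (by simp),
        Finset.sum_eq_single z'' (fun z _ hz => by simp [Ne.symm hz]) (by simp)]
      simp
    rw [Finset.sum_congr rfl fun j _ => inner j]
    simp only [partSubtensor_apply, mem_singleton]
    rw [Finset.sum_eq_single (pX x'', pY y'', pZ z'') (fun j _ hj => ?_) (by simp)]
    · simp
    · rw [if_neg]
      rintro ⟨h1, h2, h3⟩
      exact hj (Prod.ext h1.symm (Prod.ext h2.symm h3.symm))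
  rw [key] at h
  exact h

omit [Fintype PX] [Fintype PY] [Fintype PZ] in
/-- **The same over any family of cells containing the support**: if every non-zero entry of `T`
lies in a cell `e j'` of the family `e : J' → PX × PY × PZ` (injective), then
`⊕_{j'} T‖_{cell e j'} ≥ T`. [cite: VassilevskaWilliamsXuXuZhou2024, Thm. 5.3 (proof)] -/
theorem tensorRestrictsTo_directSum_cells_of_subset {J' : Type*} [Fintype J'] [DecidableEq J']
    (T : X → Y → Z → K) {e : J' → PX × PY × PZ} (he : Function.Injective e)
    (hsupp : ∀ x y z, T x y z ≠ 0 → ∃ j', e j' = (pX x, pY y, pZ z)) :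
    TensorRestrictsTo
      (familyDirectSum fun j' : J' => partSubtensor pX pY pZ T {(e j').1} {(e j').2.1} {(e j').2.2}) T := by
  classical
  have h := familyDirectSum_le_sum_blocks
    (fun j' : J' => partSubtensor pX pY pZ T {(e j').1} {(e j').2.1} {(e j').2.2})
    (fun _ (x'' : X) x => if x'' = x then (1 : K) else 0) (fun _ (y'' : Y) y => if y'' = y then (1 : K) else 0)
    (fun _ (z'' : Z) z => if z'' = z then (1 : K) else 0)
  have key : (fun x'' y'' z'' => ∑ j' : J', ∑ x, ∑ y, ∑ z,
      (if x'' = x then (1 : K) else 0) * (if y'' = y then (1 : K) else 0) * (if z'' = z then (1 : K) else 0) *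
        partSubtensor pX pY pZ T {(e j').1} {(e j').2.1} {(e j').2.2} x y z) = T := by
    funext x'' y'' z''
    have inner : ∀ j' : J', (∑ x, ∑ y, ∑ z,
        (if x'' = x then (1 : K) else 0) * (if y'' = y then (1 : K) else 0) * (if z'' = z then (1 : K) else 0) *
          partSubtensor pX pY pZ T {(e j').1} {(e j').2.1} {(e j').2.2} x y z) =
        partSubtensor pX pY pZ T {(e j').1} {(e j').2.1} {(e j').2.2} x'' y'' z'' := by
      intro j'
      rw [Finset.sum_eq_single x'' (fun x _ hx => by simp [Ne.symm hx]) (by simp),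
        Finset.sum_eq_single y'' (fun y _ hy => by simp [Ne.symm hy]) (by simp),
        Finset.sum_eq_single z'' (fun z _ hz => by simp [Ne.symm hz]) (by simp)]
      simp
    rw [Finset.sum_congr rfl fun j _ => inner j]
    simp only [partSubtensor_apply, mem_singleton]
    by_cases hT : T x'' y'' z'' = 0
    · rw [hT]
      simp
    · obtain ⟨j₀, hj₀⟩ := hsupp x'' y'' z'' hT
      rw [Finset.sum_eq_single j₀ (fun j' _ hj => ?_) (by simp)]
      · rw [if_pos]
        rw [hj₀]; exact ⟨rfl, rfl, rfl⟩
      · rw [if_neg]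
        rintro ⟨h1, h2, h3⟩
        apply hj
        apply he
        rw [hj₀]
        exact Prod.ext h1.symm (Prod.ext h2.symm h3.symm)
  rw [key] at h
  exact h

end Literature.Computability.AlgebraicComplexity
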